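import Mathlib.RepresentationTheory.Homological.GroupCohomology.Functoriality
import Literature.AnabelianGeometry.EtaleTheta.BiKummerKummerClass
import Literature.AnabelianGeometry.EtaleTheta.BiKummerThm44SubProofs
import HarnessLib

/-!
# [EtTh] Theorem 4.4 (iii), the Kummer-class clause (sub-DAG row `EtTh:Thm4.4(iii)/T44-L16`) — TYPED AND PROVED

S. Mochizuki, *The étale theta function and its Frobenioid-theoretic manifestations*, Publ. RIMS **45**
(2009) [MochizukiEtTh2009], §4, Theorem 4.4 (iii), PDF p.94 (printed 320), last two sentences:
"Suppose that, for `i = 1, 2`, `A_i` is `(N, H_{⊙,i}, f_i)`-saturated.  Then the isomorphism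
`H¹(H_{A₁}, μ_N(A₁)) ⥲ H¹(H_{A₂}, μ_N(A₂))` maps `κ_{f₁} ↦ κ_{f₂}`, i.e., is compatible with the Kummer classes
of [Mzk18], Definition 2.1, (ii)" [cite: MochizukiEtTh2009, Thm 4.4 (iii) p.94]; proof PDF p.95 ll.14–17:
"The remainder of assertions (ii), (iii) then follows immediately from the observations thus far, the
existence of `Ψ^bs`, and the «manifestly category-theoretic nature» of … Kummer classes [cf. [Mzk18],
Definition 2.1, (ii)]".

The statements of record of Thm 4.4 are `BiKummerSetting.Thm44Hyp`, `Thm44_i`–`Thm44_iv` (`BiKummerRoots.lean`,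
v5, owner abc-iut-L2-t3); `Thm44_iii` renders the SATURATION clause of (iii) only (its docstring deferred the
Kummer-class clause to the [FrdII] Def 2.1 (ii) Kummer class, now in the tree and instantiated for the §4 setting
in `BiKummerKummerClass.lean`: `BiKummerSetting.kummerClassOfRoot` / `kummerClassOfSaturated`).  This file TYPES
the clause as the sub-node `Thm44Hyp.PreservesKummerClass` of `plan/L2/SUBDAG-EtTh-Thm44.md` (row T44-L16) and
PROVES it from the sub-nodes T44-L09c (`GaloisCompatible`: `Ψ` carries `H_A` onto `H_{Ψ A}`) and T44-L10 (c)
(`BiratCompatible.aut`: `ψ_A : O^×(A^birat) ⥲ O^×(Ψ(A)^birat)` is `Aut`-equivariant) — print's "manifestly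
category-theoretic nature of Kummer classes": an `N`-th root `g` of `f₁` goes to the `N`-th root `ψ g` of
`f₂ = ψ f₁`, and `σ·g = ζ_σ g` goes to `Ψ(σ)·ψ(g) = ψ(ζ_σ) ψ(g)`.
* `Thm44Hyp.autIso` (`Aut_{C₁}(A) ≅ Aut_{C₂}(Ψ A)`, `Ψ` fully faithful), `Thm44Hyp.map_HA_eq` / `haIso`
  (`Ψ(H_A) = H_{Ψ A}`, `H_A ≅ H_{Ψ A}`, from T44-L09c), `Thm44Hyp.psiCoeff` / `muIso` (`μ_N(A₁) ≅ μ_N(A₂)` from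
  `ψ_A`) and "the isomorphism `H¹(H_{A₁}, μ_N(A₁)) ⥲ H¹(H_{A₂}, μ_N(A₂))`" `Thm44Hyp.isoH1` (Mathlib
  `groupCohomology.mapIso`) — the pattern of abc-iut-L1-d4's `Def22Context.Iso.isoH1` ([FrdII] Thm 2.4 (i)
  transport, `PadicKummerIsoTransport.lean`), re-done for the §4 setting (universe-polymorphic up to `muIso`;
  the `H¹` part at Hom- and monoid-universe `0`, see `BiKummerKummerClass.lean` note 3);
* `Thm44Hyp.isoH1_kummerClassOfRoot` and **T44-L16** `Thm44Hyp.preservesKummerClass_of` — PROVED;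
  `Thm44Hyp.thm44_iii_and_kummerClass_of_inputs` — (iii) in full (saturation clause `Thm44_iii` and the
  Kummer-class clause) from the printed proof's named inputs.
Modelling notes 1–2 of `BiKummerKummerClass.lean` (`H_A` as a subgroup of `Aut_C(A)`; `μ_N` of `O^×(A^birat)`) apply.
DEFS-FREEZE (L2, 2026-08-26T05:00Z) reading: def-bearing = transport isomorphisms CONSTRUCTED over the frozen
interface plus the printed clause TYPED AND PROVED in the same file; no new `Prop` fact, no new field.  HONEST
FRAMING: refereed pre-IUT material ([EtTh] 2009); nothing here bears on [IUTchIII] Cor. 3.12; the named INPUT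
sub-nodes T44-L09c / T44-L10 remain hypotheses where they appear.
-/

noncomputable section

namespace Literature.AnabelianGeometry.EtaleTheta

open CategoryTheory Opposite Literature.AlgebraicGeometry.Frobenioids groupCohomology

namespace BiKummerSetting

universe u₀ v₀ u v w

/-! ### `Aut_{C₁}(A) ≅ Aut_{C₂}(Ψ A)` and `H_A ≅ H_{Ψ A}` induced by `Ψ` (universe-polymorphic) -/

section AutTransport

variable {K : Type u₀} [Field K] {K' : Type u₀} [Field K'] {D₀ : Type u₀} [Category.{v₀} D₀]
  {V : FrdIMonoidStub.{w}}
  {X₁ : SemiGraphs.TemperedArithmeticGroup.{u₀} K} {X₂ : SemiGraphs.TemperedArithmeticGroup.{u₀} K'}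
  {D₀' : Type u₀} [Category.{v₀} D₀']
  {T₁ : RealifiedDivisorMonoids (D₀ := D₀) V} {T₂ : RealifiedDivisorMonoids (D₀ := D₀') V}
  {D₁ D₂ : Type u} [Category.{v} D₁] [Category.{v} D₂] {VD₁ : FrdICatStub.{u, v, w} D₁}
  {VD₂ : FrdICatStub.{u, v, w} D₂} {S₁ : BiKummerSetting X₁ T₁ D₁ VD₁} {S₂ : BiKummerSetting X₂ T₂ D₂ VD₂}
  (h : Thm44Hyp S₁ S₂)

/-- "the isomorphism `Aut_{C₁}(A) ⥲ Aut_{C₂}(Ψ A)`" induced by the equivalence `Ψ` (Thm 4.4 (iv) p.94), as a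
group isomorphism (`Ψ` is fully faithful). [cite: MochizukiEtTh2009, Thm 4.4 p.94] -/
def Thm44Hyp.autIso (A : S₁.C) : Aut A ≃* Aut (h.Ψ.functor.obj A) :=
  h.Ψ.fullyFaithfulFunctor.autMulEquivOfFullyFaithful A

/-- `autIso A σ = Ψ(σ)`. [cite: MochizukiEtTh2009, Thm 4.4 p.94] -/
@[simp] theorem Thm44Hyp.autIso_apply (A : S₁.C) (σ : Aut A) : h.autIso A σ = h.Ψ.functor.mapAut A σ := rfl

/-- `autIso A`, as a homomorphism, is `Ψ.mapAut A`. [cite: MochizukiEtTh2009, Thm 4.4 p.94] -/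
theorem Thm44Hyp.coe_autIso (A : S₁.C) :
    (h.autIso A : Aut A →* Aut (h.Ψ.functor.obj A)) = h.Ψ.functor.mapAut A :=
  MonoidHom.ext fun _ => rfl

/-- Under T44-L09c: `Ψ(τ) ∈ H_{Ψ A}` iff `τ ∈ H_A` (`H_A`, `H_{Ψ A}` the preimages of `H_A^bs`, `H_{Ψ A}^bs`
under `Aut_C(−) → Aut_D((−)^bs)`, Def 4.1 (ii); `Ψ^bs` carries `H_A^bs` onto `H_{Ψ A}^bs` and is faithful).
[cite: MochizukiEtTh2009, Thm 4.4 p.95] -/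
theorem Thm44Hyp.mapAut_mem_HA_iff (h9 : h.GaloisCompatible) {A : S₁.C} (hA : S₁.IsGalois A)
    (hA' : S₂.IsGalois (h.Ψ.functor.obj A)) (τ : Aut A) :
    h.Ψ.functor.mapAut A τ ∈ S₂.HA (h.Ψ.functor.obj A) hA' ↔ τ ∈ S₁.HA A hA := by
  obtain ⟨hA'', hmap⟩ := h9 A hA
  change S₂.autBase _ (h.Ψ.functor.mapAut A τ) ∈ S₂.HAbs _ hA' ↔ S₁.autBase A τ ∈ S₁.HAbs A hA
  rw [h.autBase_mapAut, ← hmap]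
  exact Subgroup.mem_map_iff_mem (h.transportBaseAut_injective A)

/-- **`Ψ` carries `H_A` onto `H_{Ψ A}`** (the group-level form of T44-L09c used by (iii)):
`Ψ(H_A) = H_{Ψ A}` in `Aut_{C₂}(Ψ A)`. [cite: MochizukiEtTh2009, Thm 4.4 p.95] -/
theorem Thm44Hyp.map_HA_eq (h9 : h.GaloisCompatible) {A : S₁.C} (hA : S₁.IsGalois A)
    (hA' : S₂.IsGalois (h.Ψ.functor.obj A)) :
    (S₁.HA A hA).map (h.Ψ.functor.mapAut A) = S₂.HA (h.Ψ.functor.obj A) hA' := by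
  ext τ'
  constructor
  · rintro ⟨τ, hτ, rfl⟩
    exact (h.mapAut_mem_HA_iff h9 hA hA' τ).2 hτ
  · intro hτ'
    obtain ⟨τ, rfl⟩ := (h.autIso A).surjective τ'
    exact ⟨τ, (h.mapAut_mem_HA_iff h9 hA hA' τ).1 hτ', rfl⟩

/-- "the isomorphism `H_{A₁} ⥲ H_{A₂}`" induced by `Ψ` (Thm 4.4 (iii)/(iv) p.94): `H_A ≅ H_{Ψ A}`, `τ ↦ Ψ(τ)`,
under T44-L09c. [cite: MochizukiEtTh2009, Thm 4.4 p.94] -/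
def Thm44Hyp.haIso (h9 : h.GaloisCompatible) {A : S₁.C} (hA : S₁.IsGalois A)
    (hA' : S₂.IsGalois (h.Ψ.functor.obj A)) : S₁.HA A hA ≃* S₂.HA (h.Ψ.functor.obj A) hA' :=
  ((h.autIso A).subgroupMap (S₁.HA A hA)).trans
    (MulEquiv.subgroupCongr (by rw [h.coe_autIso]; exact h.map_HA_eq h9 hA hA'))

/-- `haIso` is `Ψ` on elements. [cite: MochizukiEtTh2009, Thm 4.4 p.94] -/
@[simp] theorem Thm44Hyp.coe_haIso (h9 : h.GaloisCompatible) {A : S₁.C} (hA : S₁.IsGalois A)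
    (hA' : S₂.IsGalois (h.Ψ.functor.obj A)) (τ : S₁.HA A hA) :
    ((h.haIso h9 hA hA' τ : S₂.HA (h.Ψ.functor.obj A) hA') : Aut (h.Ψ.functor.obj A)) =
      h.Ψ.functor.mapAut A τ :=
  rfl

/-- `haIso⁻¹` is `Ψ⁻¹` (`autIso⁻¹`) on elements. [cite: MochizukiEtTh2009, Thm 4.4 p.94] -/
@[simp] theorem Thm44Hyp.coe_haIso_symm (h9 : h.GaloisCompatible) {A : S₁.C} (hA : S₁.IsGalois A)
    (hA' : S₂.IsGalois (h.Ψ.functor.obj A)) (τ : S₂.HA (h.Ψ.functor.obj A) hA') :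
    (((h.haIso h9 hA hA').symm τ : S₁.HA A hA) : Aut A) = (h.autIso A).symm τ := by
  obtain ⟨τ₁, rfl⟩ := (h.haIso h9 hA hA').surjective τ
  rw [MulEquiv.symm_apply_apply, coe_haIso, ← autIso_apply, MulEquiv.symm_apply_apply]

variable (ψ : ∀ A : S₁.C, S₁.biratUnits A ≃* S₂.biratUnits (h.Ψ.functor.obj A))

/-- `ψ_A : O^×(A^birat) ⥲ O^×(Ψ(A)^birat)` ("`f₁ ↦ f₂` via `Ψ^birat`") on the coefficient synonyms.
[cite: MochizukiEtTh2009, Thm 4.4 p.94] -/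
def Thm44Hyp.psiCoeff (A : S₁.C) : S₁.BiratCoeff A ≃* S₂.BiratCoeff (h.Ψ.functor.obj A) :=
  ((BiratCoeff.of A).symm.trans (ψ A)).trans (BiratCoeff.of (h.Ψ.functor.obj A))

/-- `psiCoeff` is `ψ_A`. [cite: MochizukiEtTh2009, Thm 4.4 p.94] -/
@[simp] theorem Thm44Hyp.psiCoeff_of (A : S₁.C) (f : S₁.biratUnits A) :
    h.psiCoeff ψ A (BiratCoeff.of A f) = BiratCoeff.of (h.Ψ.functor.obj A) (ψ A f) := rfl

/-- Under T44-L10 (c), `ψ_A` is equivariant along `Aut_{C₁}(A) → Aut_{C₂}(Ψ A)`: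
`ψ_A(σ · x) = Ψ(σ) · ψ_A(x)`. [cite: MochizukiEtTh2009, Thm 4.4 p.95] -/
theorem Thm44Hyp.psiCoeff_smul (h10 : h.BiratCompatible ψ) {A : S₁.C} (σ : Aut A) (x : S₁.BiratCoeff A) :
    h.psiCoeff ψ A (σ • x) = h.Ψ.functor.mapAut A σ • h.psiCoeff ψ A x := by
  exact h10.aut σ x

end AutTransport

/-! ### Kummer classes in the §4 setting and their transport along `Ψ` (Hom- and monoid-universe `0`) -/

section KummerClass

variable {K : Type u₀} [Field K] {K' : Type u₀} [Field K'] {D₀ : Type u₀} [Category.{v₀} D₀]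
  {V : FrdIMonoidStub.{0}}
  {X₁ : SemiGraphs.TemperedArithmeticGroup.{u₀} K} {X₂ : SemiGraphs.TemperedArithmeticGroup.{u₀} K'}
  {D₀' : Type u₀} [Category.{v₀} D₀']
  {T₁ : RealifiedDivisorMonoids (D₀ := D₀) V} {T₂ : RealifiedDivisorMonoids (D₀ := D₀') V}
  {D₁ D₂ : Type u} [Category.{0} D₁] [Category.{0} D₂] {VD₁ : FrdICatStub.{u, 0, 0} D₁}
  {VD₂ : FrdICatStub.{u, 0, 0} D₂}

variable {S₁ : BiKummerSetting X₁ T₁ D₁ VD₁} {S₂ : BiKummerSetting X₂ T₂ D₂ VD₂} (h : Thm44Hyp S₁ S₂)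
  (ψ : ∀ A : S₁.C, S₁.biratUnits A ≃* S₂.biratUnits (h.Ψ.functor.obj A))

/-! #### `μ_N(A₁) ⥲ μ_N(A₂)` -/

/-- The isomorphism `μ_N(A₁) ⥲ μ_N(A₂)` of cyclotomic portions induced by `ψ_A` (the coefficients of "the
isomorphism `H¹(H_{A₁}, μ_N(A₁)) ⥲ H¹(H_{A₂}, μ_N(A₂))`"). [cite: MochizukiEtTh2009, Thm 4.4 (iii) p.94] -/
def Thm44Hyp.muIso (A : S₁.C) (N : ℕ) :
    Kummer.Mu N (S₁.BiratCoeff A) ≃* Kummer.Mu N (S₂.BiratCoeff (h.Ψ.functor.obj A)) where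
  toFun ζ := Kummer.Mu.mk (Units.map (h.psiCoeff ψ A).toMonoidHom ζ.val) (by
    have hζ := ζ.val_mem
    rw [mem_rootsOfUnity] at hζ ⊢
    rw [← map_pow, hζ, map_one])
  invFun ξ := Kummer.Mu.mk (Units.map (h.psiCoeff ψ A).symm.toMonoidHom ξ.val) (by
    have hξ := ξ.val_mem
    rw [mem_rootsOfUnity] at hξ ⊢
    rw [← map_pow, hξ, map_one])
  left_inv ζ := Kummer.Mu.ext (Units.ext (by simp))
  right_inv ξ := Kummer.Mu.ext (Units.ext (by simp))
  map_mul' ζ ζ' := Kummer.Mu.ext (by simp only [Kummer.Mu.val_mk, Kummer.Mu.val_mul, map_mul])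

/-- `muIso` on underlying elements. [cite: MochizukiEtTh2009, Thm 4.4 (iii) p.94] -/
@[simp] theorem Thm44Hyp.coe_val_muIso (A : S₁.C) (N : ℕ) (ζ : Kummer.Mu N (S₁.BiratCoeff A)) :
    ((h.muIso ψ A N ζ).val : S₂.BiratCoeff (h.Ψ.functor.obj A)) = h.psiCoeff ψ A (ζ.val : S₁.BiratCoeff A) :=
  rfl

/-- `muIso⁻¹` on underlying elements. [cite: MochizukiEtTh2009, Thm 4.4 (iii) p.94] -/
@[simp] theorem Thm44Hyp.coe_val_muIso_symm (A : S₁.C) (N : ℕ)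
    (ξ : Kummer.Mu N (S₂.BiratCoeff (h.Ψ.functor.obj A))) :
    (((h.muIso ψ A N).symm ξ).val : S₁.BiratCoeff A) = (h.psiCoeff ψ A).symm (ξ.val : S₂.BiratCoeff _) :=
  rfl

/-- Under T44-L10 (c), `muIso` is equivariant along `Aut_{C₁}(A) → Aut_{C₂}(Ψ A)`.
[cite: MochizukiEtTh2009, Thm 4.4 p.95] -/
theorem Thm44Hyp.muIso_smul (h10 : h.BiratCompatible ψ) {A : S₁.C} (N : ℕ) (σ : Aut A)
    (ζ : Kummer.Mu N (S₁.BiratCoeff A)) :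
    h.muIso ψ A N (σ • ζ) = h.Ψ.functor.mapAut A σ • h.muIso ψ A N ζ :=
  Kummer.Mu.ext (Units.ext (by
    rw [coe_val_muIso, Kummer.Mu.val_smul, Kummer.coe_unitsAct, h.psiCoeff_smul ψ h10, Kummer.Mu.val_smul,
      Kummer.coe_unitsAct, coe_val_muIso]))

/-- Under T44-L10 (c), `muIso⁻¹` is equivariant along `Aut_{C₂}(Ψ A) → Aut_{C₁}(A)`.
[cite: MochizukiEtTh2009, Thm 4.4 p.95] -/
theorem Thm44Hyp.muIso_symm_smul (h10 : h.BiratCompatible ψ) {A : S₁.C} (N : ℕ)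
    (τ : Aut (h.Ψ.functor.obj A)) (ξ : Kummer.Mu N (S₂.BiratCoeff (h.Ψ.functor.obj A))) :
    (h.muIso ψ A N).symm (τ • ξ) = (h.autIso A).symm τ • (h.muIso ψ A N).symm ξ := by
  apply (h.muIso ψ A N).injective
  rw [MulEquiv.apply_symm_apply, h.muIso_smul ψ h10, MulEquiv.apply_symm_apply, ← autIso_apply,
    MulEquiv.apply_symm_apply]

/-! #### "the isomorphism `H¹(H_{A₁}, μ_N(A₁)) ⥲ H¹(H_{A₂}, μ_N(A₂))`" -/

section H1

variable {A : S₁.C}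

/-- `μ_N(A₂) ⥲ μ_N(A₁)`, additively and `ℤ`-linearly (the coefficient isomorphism fed to Mathlib's
`groupCohomology.mapIso`). [cite: MochizukiEtTh2009, Thm 4.4 (iii) p.94] -/
def Thm44Hyp.muAddLinearEquiv (N : ℕ) :
    Additive (Kummer.Mu N (S₂.BiratCoeff (h.Ψ.functor.obj A))) ≃ₗ[ℤ] Additive (Kummer.Mu N (S₁.BiratCoeff A)) :=
  (MulEquiv.toAdditive (h.muIso ψ A N).symm).toIntLinearEquiv

/-- Under T44-L10 (c), `muAddLinearEquiv` intertwines the `H_{A₂}`-action with the `H_{A₁}`-action along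
`H_{A₂} ⥲ H_{A₁}`. [cite: MochizukiEtTh2009, Thm 4.4 p.95] -/
theorem Thm44Hyp.muAddLinearEquiv_comm (h9 : h.GaloisCompatible) (hA : S₁.IsGalois A)
    (hA' : S₂.IsGalois (h.Ψ.functor.obj A)) (N : ℕ) (h10 : h.BiratCompatible ψ)
    (g : S₂.HA (h.Ψ.functor.obj A) hA') :
    (h.muAddLinearEquiv ψ (A := A) N).toLinearMap ∘ₗ
        (Rep.ofMulDistribMulAction (S₂.HA (h.Ψ.functor.obj A) hA')
          (Kummer.Mu N (S₂.BiratCoeff (h.Ψ.functor.obj A)))).ρ g =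
      (Rep.ofMulDistribMulAction (S₁.HA A hA) (Kummer.Mu N (S₁.BiratCoeff A))).ρ ((h.haIso h9 hA hA').symm g) ∘ₗ
        (h.muAddLinearEquiv ψ (A := A) N).toLinearMap := by
  apply LinearMap.ext
  intro (x : Additive (Kummer.Mu N (S₂.BiratCoeff (h.Ψ.functor.obj A))))
  show Additive.ofMul ((h.muIso ψ A N).symm (Additive.toMul (Additive.ofMul
      (((g : S₂.HA (h.Ψ.functor.obj A) hA') : Aut (h.Ψ.functor.obj A)) • Additive.toMul x)))) =
    Additive.ofMul ((((h.haIso h9 hA hA').symm g : S₁.HA A hA) : Aut A) • Additive.toMul (Additive.ofMul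
      ((h.muIso ψ A N).symm (Additive.toMul x))))
  rw [toMul_ofMul, toMul_ofMul, h.muIso_symm_smul ψ h10, coe_haIso_symm]

/-- The isomorphism `H¹(H_{A₂}, μ_N(A₂)) ≅ H¹(H_{A₁}, μ_N(A₁))` of group cohomology induced by the pair
`(H_{A₂} ⥲ H_{A₁}, μ_N(A₂) ⥲ μ_N(A₁))` (Mathlib `groupCohomology.mapIso`). [cite: MochizukiEtTh2009, Thm 4.4 (iii) p.94] -/
def Thm44Hyp.h1Iso (h9 : h.GaloisCompatible) (hA : S₁.IsGalois A)
    (hA' : S₂.IsGalois (h.Ψ.functor.obj A)) (N : ℕ) (h10 : h.BiratCompatible ψ) :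
    groupCohomology (Rep.ofMulDistribMulAction (S₂.HA (h.Ψ.functor.obj A) hA')
        (Kummer.Mu N (S₂.BiratCoeff (h.Ψ.functor.obj A)))) 1 ≅
      groupCohomology (Rep.ofMulDistribMulAction (S₁.HA A hA) (Kummer.Mu N (S₁.BiratCoeff A))) 1 :=
  groupCohomology.mapIso (h.haIso h9 hA hA').symm (h.muAddLinearEquiv ψ N)
    (h.muAddLinearEquiv_comm ψ h9 hA hA' N h10) 1

/-- **"the isomorphism `H¹(H_{A₁}, μ_N(A₁)) ⥲ H¹(H_{A₂}, μ_N(A₂))`"** induced by `Ψ` (through `H_{A₁} ≅ H_{A₂}`,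
T44-L09c) and `Ψ^birat` (through `μ_N(A₁) ≅ μ_N(A₂)`, T44-L10 (c)) — Mathlib group cohomology of the discrete
`H_{A_i}`, where the [FrdII] Def 2.1 (ii) Kummer classes live. [cite: MochizukiEtTh2009, Thm 4.4 (iii) p.94] -/
def Thm44Hyp.isoH1 (h9 : h.GaloisCompatible) (hA : S₁.IsGalois A)
    (hA' : S₂.IsGalois (h.Ψ.functor.obj A)) (N : ℕ) (h10 : h.BiratCompatible ψ) :
    H1 (Rep.ofMulDistribMulAction (S₁.HA A hA) (Kummer.Mu N (S₁.BiratCoeff A))) ≃+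
      H1 (Rep.ofMulDistribMulAction (S₂.HA (h.Ψ.functor.obj A) hA')
        (Kummer.Mu N (S₂.BiratCoeff (h.Ψ.functor.obj A)))) :=
  (h.h1Iso ψ h9 hA hA' N h10).symm.toLinearEquiv.toAddEquiv

/-- The coefficient morphism `res (μ_N(A₁)) → μ_N(A₂)` over `H_{A₂} → H_{A₁}` underlying `isoH1`.
[cite: MochizukiEtTh2009, Thm 4.4 (iii) p.94] -/
def Thm44Hyp.muRepHom (h9 : h.GaloisCompatible) (hA : S₁.IsGalois A)
    (hA' : S₂.IsGalois (h.Ψ.functor.obj A)) (N : ℕ) (h10 : h.BiratCompatible ψ) :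
    Rep.res ((h.haIso h9 hA hA').symm : S₂.HA (h.Ψ.functor.obj A) hA' →* S₁.HA A hA)
        (Rep.ofMulDistribMulAction (S₁.HA A hA) (Kummer.Mu N (S₁.BiratCoeff A))) ⟶
      Rep.ofMulDistribMulAction (S₂.HA (h.Ψ.functor.obj A) hA')
        (Kummer.Mu N (S₂.BiratCoeff (h.Ψ.functor.obj A))) :=
  Rep.ofHom
    { toLinearMap := (h.muAddLinearEquiv ψ (A := A) N).symm.toLinearMap
      isIntertwining' := fun g => by
        apply LinearMap.ext
        intro (x : Additive (Kummer.Mu N (S₁.BiratCoeff A)))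
        show Additive.ofMul (h.muIso ψ A N (Additive.toMul (Additive.ofMul
            ((((h.haIso h9 hA hA').symm g : S₁.HA A hA) : Aut A) • Additive.toMul x)))) =
          Additive.ofMul (((g : S₂.HA (h.Ψ.functor.obj A) hA') : Aut (h.Ψ.functor.obj A)) •
            Additive.toMul (Additive.ofMul (h.muIso ψ A N (Additive.toMul x))))
        rw [toMul_ofMul, toMul_ofMul, h.muIso_smul ψ h10, coe_haIso_symm, ← autIso_apply,
          MulEquiv.apply_symm_apply] }

/-- `isoH1` is the map on `H¹` induced by `(H_{A₂} → H_{A₁}, μ_N(A₁) → μ_N(A₂))`.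
[cite: MochizukiEtTh2009, Thm 4.4 (iii) p.94] -/
theorem Thm44Hyp.isoH1_apply (h9 : h.GaloisCompatible) (hA : S₁.IsGalois A)
    (hA' : S₂.IsGalois (h.Ψ.functor.obj A)) (N : ℕ) (h10 : h.BiratCompatible ψ)
    (x : H1 (Rep.ofMulDistribMulAction (S₁.HA A hA) (Kummer.Mu N (S₁.BiratCoeff A)))) :
    h.isoH1 ψ h9 hA hA' N h10 x =
      (groupCohomology.map ((h.haIso h9 hA hA').symm : S₂.HA (h.Ψ.functor.obj A) hA' →* S₁.HA A hA)
        (h.muRepHom ψ h9 hA hA' N h10) 1).hom x :=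
  rfl

/-- `isoH1` on the class of a 1-cocycle `c` is the class of the transported cocycle `τ ↦ muIso (c (haIso⁻¹ τ))`.
[cite: MochizukiEtTh2009, Thm 4.4 (iii) p.94] -/
theorem Thm44Hyp.isoH1_H1π (h9 : h.GaloisCompatible) (hA : S₁.IsGalois A)
    (hA' : S₂.IsGalois (h.Ψ.functor.obj A)) (N : ℕ) (h10 : h.BiratCompatible ψ)
    (c : cocycles₁ (Rep.ofMulDistribMulAction (S₁.HA A hA) (Kummer.Mu N (S₁.BiratCoeff A)))) :
    h.isoH1 ψ h9 hA hA' N h10 (H1π _ c) =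
      H1π _ (mapCocycles₁ ((h.haIso h9 hA hA').symm : S₂.HA (h.Ψ.functor.obj A) hA' →* S₁.HA A hA)
        (h.muRepHom ψ h9 hA hA' N h10) c) := by
  rw [isoH1_apply]
  exact H1π_comp_map_apply _ _ c

/-! #### T44-L16: the Kummer-class clause of Thm 4.4 (iii) -/

/-- **Thm 4.4 (iii), Kummer-class clause, at the level of roots**: the isomorphism
`H¹(H_{A₁}, μ_N(A₁)) ⥲ H¹(H_{A₂}, μ_N(A₂))` maps the Kummer class of `f` computed from the root `g` to the Kummer
class of `ψ f` computed from the root `ψ g` — PROVED from T44-L09c and T44-L10 (c) at the level of cocycles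
(`σ·g = ζ_σ g` goes to `Ψ(σ)·ψ(g) = ψ(ζ_σ) ψ(g)`; "the manifestly category-theoretic nature of Kummer classes",
p.95). [cite: MochizukiEtTh2009, Thm 4.4 (iii) p.94] -/
theorem Thm44Hyp.isoH1_kummerClassOfRoot (h9 : h.GaloisCompatible) (hA : S₁.IsGalois A)
    (hA' : S₂.IsGalois (h.Ψ.functor.obj A)) (N : ℕ)
    (h10 : h.BiratCompatible ψ) {f g : S₁.biratUnits A} (hg : g ^ N = f)
    (hf : S₁.IsFixedByHA A hA f) (hf' : S₂.IsFixedByHA (h.Ψ.functor.obj A) hA' (ψ A f))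
    (hg' : ψ A g ^ N = ψ A f) :
    h.isoH1 ψ h9 hA hA' N h10 (S₁.kummerClassOfRoot hA N hg hf) = S₂.kummerClassOfRoot hA' N hg' hf' := by
  rw [kummerClassOfRoot, kummerClassOfRoot, Kummer.kummerClassOfRoot, Kummer.kummerClassOfRoot, isoH1_H1π]
  congr 1
  refine cocycles₁_ext fun τ => ?_
  rw [coe_mapCocycles₁]
  change Additive.ofMul (h.muIso ψ A N (Kummer.kummerCocycle (BiratCoeff.nthRootsDifferByUnits S₁ A N)
      (S₁.HA A hA) hg (BiratCoeff.smul_of_eq_of_isFixedByHA hf) ((h.haIso h9 hA hA').symm τ))) =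
    Additive.ofMul (Kummer.kummerCocycle (BiratCoeff.nthRootsDifferByUnits S₂ (h.Ψ.functor.obj A) N)
      (S₂.HA (h.Ψ.functor.obj A) hA') hg' (BiratCoeff.smul_of_eq_of_isFixedByHA hf') τ)
  congr 1
  symm
  apply Kummer.kummerCocycle_eq_of_smul_eq
  have hτ : (τ : Aut (h.Ψ.functor.obj A)) =
      h.Ψ.functor.mapAut A (((h.haIso h9 hA hA').symm τ : S₁.HA A hA) : Aut A) := by
    rw [coe_haIso_symm, ← autIso_apply, MulEquiv.apply_symm_apply]
  have e := congrArg (h.psiCoeff ψ A) (Kummer.smul_root_eq (BiratCoeff.nthRootsDifferByUnits S₁ A N)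
    (S₁.HA A hA) hg (BiratCoeff.smul_of_eq_of_isFixedByHA hf) ((h.haIso h9 hA hA').symm τ))
  rw [h.psiCoeff_smul ψ h10, map_mul, ← hτ] at e
  rw [← coe_val_muIso] at e
  exact e

/-- **T44-L16 — Thm 4.4 (iii), the Kummer-class clause** (p.94): "Suppose that, for `i = 1, 2`, `A_i` is
`(N, H_{⊙,i}, f_i)`-saturated" [`A₂ := Ψ(A₁)`, `f₂ := ψ(f₁)`: "`A₁ ↦ A₂` via `Ψ`, `f₁ ↦ f₂` via `Ψ^birat`"].
"Then the isomorphism `H¹(H_{A₁}, μ_N(A₁)) ⥲ H¹(H_{A₂}, μ_N(A₂))` maps `κ_{f₁} ↦ κ_{f₂}`, i.e., is compatible with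
the Kummer classes of [Mzk18], Definition 2.1, (ii)."  Sub-node statement over `Thm44Hyp` data, the isomorphism
being the one induced by `Ψ` (T44-L09c) and `ψ` (T44-L10 (c)); modelling notes 1–3 of the file header apply.
[cite: MochizukiEtTh2009, Thm 4.4 (iii) p.94] -/
def Thm44Hyp.PreservesKummerClass (h9 : h.GaloisCompatible) (h10 : h.BiratCompatible ψ) : Prop :=
  ∀ (A : S₁.C) (N : ℕ+) (f : S₁.biratUnits A) (hs₁ : S₁.IsSaturated A N f)
    (hs₂ : S₂.IsSaturated (h.Ψ.functor.obj A) N (ψ A f)),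
    h.isoH1 ψ h9 hs₁.isAmple.isGalois hs₂.isAmple.isGalois N h10 (S₁.kummerClassOfSaturated hs₁) =
      S₂.kummerClassOfSaturated hs₂

/-- **T44-L16 PROVED** from T44-L09c and T44-L10 (c): the Kummer class does not depend on the root ([FrdII]
Def 2.1 (ii)), and for the root `g` of `f₁` and the root `ψ g` of `f₂` the classes correspond
(`isoH1_kummerClassOfRoot`). [cite: MochizukiEtTh2009, Thm 4.4 (iii) p.94] -/
theorem Thm44Hyp.preservesKummerClass_of (h9 : h.GaloisCompatible) (h10 : h.BiratCompatible ψ) :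
    h.PreservesKummerClass ψ h9 h10 := by
  intro A N f hs₁ hs₂
  obtain ⟨g, hg⟩ := hs₁.cond_b
  have hg' : ψ A g ^ (N : ℕ) = ψ A f := by rw [← map_pow, hg]
  rw [kummerClassOfSaturated, kummerClassOfSaturated,
    show S₁.kummerClass hs₁.isAmple.isGalois N f hs₁.fixed hs₁.cond_b = _ from
      S₁.kummerClass_eq_kummerClassOfRoot hs₁.isAmple.isGalois N hg hs₁.fixed,
    show S₂.kummerClass hs₂.isAmple.isGalois N (ψ A f) hs₂.fixed hs₂.cond_b = _ from
      S₂.kummerClass_eq_kummerClassOfRoot hs₂.isAmple.isGalois N hg' hs₂.fixed]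
  exact h.isoH1_kummerClassOfRoot ψ h9 _ _ N h10 hg hs₁.fixed hs₂.fixed hg'

end H1

/-- **Thm 4.4 (iii) IN FULL from the printed proof's named inputs**: the saturation clause `Thm44_iii`
(`thm44_iii_of_inputs`: T44-L03, the Frobenius-type clause of [FrdI] Thm 3.4 at `Ψ⁻¹`, "`C₂` is a Frobenioid",
T44-L15b) AND the Kummer-class clause T44-L16 (T44-L09c, T44-L10 (c)). [cite: MochizukiEtTh2009, Thm 4.4 p.95] -/
theorem Thm44Hyp.thm44_iii_and_kummerClass_of_inputs (h3 : h.PreservesFrobeniusStructure)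
    (hrefl : ∀ ⦃A B : S₁.C⦄ (φ : A ⟶ B), S₂.IsFrobeniusType (h.Ψ.functor.map φ) → S₁.IsFrobeniusType φ)
    (hF₂ : PreFrobenioid.IsFrobenioid S₂.F) (h15 : h.PreservesNHSaturatedBsFld) (h9 : h.GaloisCompatible)
    (h10 : h.BiratCompatible ψ) : Thm44_iii h ψ ∧ h.PreservesKummerClass ψ h9 h10 :=
  ⟨h.thm44_iii_of_inputs ψ h3 hrefl hF₂ h15, h.preservesKummerClass_of ψ h9 h10⟩

end KummerClass

end BiKummerSetting

end Literature.AnabelianGeometry.EtaleTheta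

end
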